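import Summits.BirchSwinnertonDyer.BirchSwinnertonDyer.Theorems.ErratumRoadFiveBdvCalibrationSplitNFCalibratorSupplyCM
import Literature.NumberTheory.EllipticCurves.OrdinaryNewformDatumAttachedProofs
import Literature.NumberTheory.EllipticCurves.EisensteinNewformLevelRaisingOrdinaryProofs
import Literature.NumberTheory.EllipticCurves.PadicCoeffIntegersFrobeniusData
import Literature.FieldTheory.AlgClosed.PadicAlgClEquivComplexCompatible
import Literature.NumberTheory.EllipticCurves.BurungaleSkinnerTianWan2024.AuxiliaryNewformSupplyPRE
import Summits.BirchSwinnertonDyer.BirchSwinnertonDyer.Theorems.ErratumRoadFiveBdvCalibrationSplitNFCalibratorDefs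
import HarnessLib

/-!
# Calibrator supply S2a-NF from three named printed facts — BUILT port of the «F-irr» Sketch, file 3/3: PART D–E (module of record)

1:1 port (file 3 of 3) of `Cruxes/EulerHalfNotRamNoInertSetAtFive/Lines/calibrator_Firr_Sketch.lean` rev 1.2 —
**bytes: bsd-idea-9 g55, Cruxes/EulerHalfNotRamNoInertSetAtFive/Lines/calibrator_Firr_Sketch.lean rev 1.2 (c83736268e5f3766)**;
port record and deltas in file 1 `…Theorems.ErratumRoadFiveBdvCalibrationSplitNFCalibratorSupplyFirr`; PART B–C in file 2 `…CalibratorSupplyCM`.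
By name here: D.1 `exists_attached_isIrreducible`, D.2 `exists_calibratorRep_of_CM_clause`, D.3
`exists_compat_calibratorRep_of_CM_clause` and PART E `calibratorSupplyNF_of_printedFacts
(hW : Hida2000_thm326_ordinary_unitRoot) (h61 : DeligneSerre1974.thm61_exists_adicGaloisRep)
(hPRE : prop523proof_appB_exists_orientedCMNewform_PRE) : <item 33169 r3 `stub_calibratorSupplyNF`, token for token>` (+ E′).
Ported by the LEAD lineage bsd-line-er5-p1 (g21) on SUMMON key `s2aport` (pen bsd-stepL-plan g53; authority director-bsd
(778) (σ1)); `--supports stmt-BirchSwinnertonDyer-33169`.  HELPER ONLY: closes no registered stub by signature; PART E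
`calibratorSupplyNF_of_printedFacts` makes S2a-NF (`stub_calibratorSupplyNF` of 33169 r3, token for token) a consequence
of THREE NAMED PRINTED FACTS `hW`, `h61`, `hPRE` — a conditional theorem, not a proof of S2a-NF; typed ≠ proved; no
summit statement is proved here; BSD is proved for no curve.

The Sketch's module docstring, PART D–E paragraphs, verbatim:

PART D (rev 1.1 — the TURNKEY; `ρ` CONSTRUCTED and `hirr` DISCHARGED): for ANY `ι' : ℚ̄_p ≃ ℂ`
with `‖ι'⁻¹(a_p(g))‖ = 1` the representation `ρ := Δ.ρ ⊗ ℚ̄_p` of the integral ordinary datum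
`Δ : OrdinaryNewformDatum g p (ι'⁻¹|_{K_g})` (which EXISTS by the tree theorem
`nonempty_ordinaryNewformDatum_of_thm61_of_thm326` from Deligne's theorem
`DeligneSerre1974.thm61_exists_adicGaloisRep` and `Hida2000_thm326_ordinary`, the latter implied by
`hW` via `Hida2000_thm326_ordinary_of_unitRoot`) is attached to `(g₁, ι'⁻¹|_{K₁})` away from `Np`
(`OrdinaryNewformDatum.isGaloisRepOfNewform1_baseChange_padicAlgCl`) and IRREDUCIBLE
(`OrdinaryNewformDatum.isIrreducible_baseChange_padicAlgCl` ⇐ Ribet 1977 Thm. (2.3), PROVED in the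
tree as `Ribet1977.thm23_isIrreducible_holds`): `exists_attached_isIrreducible` (any weight `k ≥ 2`).
Hence `exists_calibratorRep_of_CM_clause` / `exists_compat_calibratorRep_of_CM_clause`: from
`hW`, `h61` and the PRE fact's output ALONE, `∃ ι' ρ` satisfying conjuncts #3 (attached), #4 (F-irr)
and #5 (ordinary) of `CalibratorSupplyNF` verbatim — no `hirr` hypothesis left.
PART E (rev 1.2 — the SUPPLY TURNKEY): `calibratorSupplyNF_of_printedFacts hW h61 hPRE` IS the
statement of `bstw_door.stub_calibratorSupplyNF` (item 33169, S2a-NF) token for token —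
`∀ p ≥ 5 prime, ∀ L` imaginary quadratic, Heegner at `p`, `d_L < −4` odd, `CalibratorSupplyNF L p`
(all EIGHT conjuncts) — from the three named printed facts `hW`, `h61`,
`hPRE = BurungaleSkinnerTianWan2024.prop523proof_appB_exists_orientedCMNewform_PRE` (typer fact
p801618, BSTW24 proof of Prop. 5.23 + App. B); the gate audit classes it `proof.conditional` of the
`@[conjecture]` `CalibratorSupplyNF` modulo exactly these three.
`lean check`: rc 0, 0 errors, 0 sorries, axioms {propext, Classical.choice, Quot.sound} for
`calibratorSupplyNF_of_printedFacts`.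
No summit statement is proved here; `CalibratorSupplyNF` is proved ONLY conditionally on the three
named facts; BSD is proved for no curve by this file.
-/

-- D-0017: single-problem summit, so `Summit.BirchSwinnertonDyer.BirchSwinnertonDyer.…` repeats a namespace BY DESIGN.
set_option linter.dupNamespace false

namespace Summit.BirchSwinnertonDyer.BirchSwinnertonDyer.Theorems.ErratumRoadFiveBdvCalibrationSplitNFCalibratorSupply

open scoped MatrixGroups NumberField Matrix
open Literature.NumberTheory.GaloisRepresentations
open Literature.NumberTheory.EllipticCurves
open Literature.NumberTheory.EllipticCurves.ModularForms
open IsDedekindDomain Field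

/-! ## PART D — the turnkey: `ρ` constructed, `hirr` discharged (rev 1.1) -/

section Turnkey

open Literature.NumberTheory.EllipticCurves.GreenbergSelmer Literature.FieldTheory.AlgClosed

/-- **D.1 (attached AND irreducible, over `ℚ̄_p`, for the comparison `ι'` you hold).**  For a newform
`g ∈ S_k(Γ₀(N))`, `k ≥ 2`, a prime `p ∤ N` and ANY `ι' : ℚ̄_p ≃+* ℂ` with `‖ι'⁻¹(a_p(g))‖ = 1`
there is `ρ : Γ_ℚ → GL₂(ℚ̄_p)` attached to the `Γ₁(N)`-lift of `g` through `ι'⁻¹|_{K₁}` away from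
`N p` which is IRREDUCIBLE: `ρ := Δ.ρ ⊗ ℚ̄_p` for the integral ordinary datum `Δ` of `(g, p, ι'⁻¹|_{K_g})`
(`nonempty_ordinaryNewformDatum_of_thm61_of_thm326`), attached by
`OrdinaryNewformDatum.isGaloisRepOfNewform1_baseChange_padicAlgCl` (the two coefficient maps
`ι'⁻¹|_{K_g} ∘ (K₁ ⊆ K_g)` and `ι'⁻¹ ∘ (K₁ ⊆ ℂ)` agree definitionally), irreducible by
`OrdinaryNewformDatum.isIrreducible_baseChange_padicAlgCl` (Ribet Thm. (2.3), PROVED in the tree;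
`K = ℚ_p(ι K_g)` is finite over `ℚ_p`, `GreenbergSelmer.finiteDimensional_padicCoeffField`, since
`K_g` is a number field, `IsNewform0.finiteDimensional_coeffField_holds`).
[cite: DeligneSerreASENS1974, Thm. 6.1] [cite: Ribet1977Nebentypus, Thm. (2.3)]
[cite: Hida2000, Thm. 3.26 (1)–(2), pp. 151–152] -/
theorem exists_attached_isIrreducible
    (h61 : DeligneSerre1974.thm61_exists_adicGaloisRep) (h326 : Hida2000_thm326_ordinary)
    {N : ℕ} [NeZero N] {k : ℤ} (g : CuspForm (CongruenceSubgroup.Gamma0 N) k) (hg : IsNewform0 g)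
    (hk : 2 ≤ k) (p : ℕ) [Fact p.Prime] (hpN : ¬ p ∣ N) (ι' : PadicAlgCl p ≃+* ℂ)
    (hap : ‖ι'.symm (cuspCoeff g p)‖ = 1) :
    ∃ ρ : FramedGaloisRep ℚ (PadicAlgCl p) 2,
      IsGaloisRepOfNewform1 (liftToGamma1 N k g)
        (ι'.symm.toRingHom.comp (algebraMap (coeffCharField (liftToGamma1 N k g)) ℂ))
        {ℓ : ℕ | ℓ ∣ N * p} ρ ∧ ρ.toGaloisRep.IsIrreducible := by
  classical
  -- the coefficient embedding `K_g → ℚ̄_p` cut out by `ι'`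
  obtain ⟨ι, hι⟩ : ∃ ι : coeffField g →+* PadicAlgCl p,
      ι = ι'.symm.toRingHom.comp (algebraMap (coeffField g) ℂ) := ⟨_, rfl⟩
  have hιap : ‖ι ⟨(UpperHalfPlane.qExpansion 1 ⇑g).coeff p, coeff_mem_coeffField g p⟩‖ = 1 := by
    rw [hι]; exact hap
  obtain ⟨Δ⟩ := nonempty_ordinaryNewformDatum_of_thm61_of_thm326 h61 h326 g hg hk p hpN ι hιap
  haveI : FiniteDimensional ℚ (coeffField g) := IsNewform0.finiteDimensional_coeffField_holds hg
  haveI : FiniteDimensional ℚ_[p] (padicCoeffField ι) :=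
    GreenbergSelmer.finiteDimensional_padicCoeffField ι
  refine ⟨FramedRep.baseChange (padicCoeffIntegers.toPadicAlgCl ι) continuous_toPadicAlgCl Δ.ρ, ?_,
    Δ.isIrreducible_baseChange_padicAlgCl hg (by omega)⟩
  have hρ := Δ.isGaloisRepOfNewform1_baseChange_padicAlgCl hg (by omega : 1 ≤ k)
  have hj : ι.comp (IntermediateField.inclusion
        (coeffCharField_liftToGamma1_le (isNewform0_ne_zero hg))).toRingHom =
      ι'.symm.toRingHom.comp (algebraMap (coeffCharField (liftToGamma1 N k g)) ℂ) := by
    subst hι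
    rfl
  rw [hj] at hρ
  exact hρ

/-- **D.2 (the calibrator's representation, for the `ι'` you hold).**  From `hW` (GRANTED Hida Thm.
3.26 (2), the cell's standard printed fact), Deligne's theorem `h61` and the BSTW App. B output
(`g` a `p`-ordinary CM newform of weight `2`, level prime to `p`, `p ≠ 2`, with its `K`-clause):
there is `ρ` attached to `(g₁, ι'⁻¹)` away from `Np` which is irreducible AND residually absolutely
irreducible — conjuncts #3 and #4 of `CalibratorSupplyNF` for the given `ι'`, with NO `hirr`
hypothesis (D.1 + Corollary C).
[cite: BurungaleSkinnerTianWan2024, Prop. 5.23 and App. B] [cite: Hida2000, Thm. 3.26 (2), p. 152]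
[cite: Ribet1977Nebentypus, Thm. (2.3)] -/
theorem exists_calibratorRep_of_CM_clause (hW : Hida2000_thm326_ordinary_unitRoot)
    (h61 : DeligneSerre1974.thm61_exists_adicGaloisRep)
    {N : ℕ} [NeZero N] (g : CuspForm (CongruenceSubgroup.Gamma0 N) 2) (hg : IsNewform0 g)
    (p : ℕ) [Fact p.Prime] (hp2 : p ≠ 2) (hpN : ¬ p ∣ N) (ι' : PadicAlgCl p ≃+* ℂ)
    (hap : ‖ι'.symm (cuspCoeff g p)‖ = 1)
    (hKcl : ∃ (K : Type) (_ : Field K) (_ : NumberField K), IsImaginaryQuadratic K ∧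
        SatisfiesHeegnerHypothesis p K ∧
        ∃ χK : DirichletCharacter ℂ (NumberField.discr K).natAbs,
          (∀ n : ℕ, Odd n → χK n = (jacobiSym (NumberField.discr K) n : ℂ)) ∧
          ∀ ℓ : ℕ, ℓ.Prime → ¬ ℓ ∣ N → χK ℓ * cuspCoeff g ℓ = cuspCoeff g ℓ) :
    ∃ ρ : FramedGaloisRep ℚ (PadicAlgCl p) 2,
      IsGaloisRepOfNewform1 (liftToGamma1 N 2 g)
        (ι'.symm.toRingHom.comp (algebraMap (coeffCharField (liftToGamma1 N 2 g)) ℂ))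
        {ℓ : ℕ | ℓ ∣ N * p} ρ ∧
      ρ.IsResiduallyAbsIrreducible ∧ ρ.toGaloisRep.IsIrreducible := by
  obtain ⟨ρ, hρ, hirr⟩ := exists_attached_isIrreducible h61 (Hida2000_thm326_ordinary_of_unitRoot hW)
    g hg le_rfl p hpN ι' hap
  exact ⟨ρ, hρ, isResiduallyAbsIrreducible_of_CM_clause hW g hg p hp2 hpN ι' hap ρ hρ hirr hKcl, hirr⟩

/-- **D.3 (conjuncts #3, #4, #5 of `CalibratorSupplyNF`, token for token, with the comparison
`ι'` produced as well).**  From `hW`, `h61` and the PRE fact's output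
`⟨N, _, g, hg, hpN, -, -, hKcl, hord, -, -⟩` alone:
`∃ ι' ρ, IsGaloisRepOfNewform1 g₁ (ι'⁻¹ ∘ (K₁ ⊆ ℂ)) {ℓ ∣ Np} ρ ∧ ρ.IsResiduallyAbsIrreducible ∧
‖ι'⁻¹(a_p(g))‖ = 1` (a ring isomorphism `ℚ̄_p ≃ ℂ` exists:
`exists_padicAlgCl_ringEquiv_complex_apply_eq_of_finiteDimensional`).  The typer's gap #4 «F-irr»
is thereby CLOSED modulo exactly the two named printed facts `hW`, `h61`.
[cite: BurungaleSkinnerTianWan2024, Prop. 5.23 and App. B] [cite: Hida2000, Thm. 3.26 (2), p. 152]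
[cite: DeligneSerreASENS1974, Thm. 6.1] -/
theorem exists_compat_calibratorRep_of_CM_clause (hW : Hida2000_thm326_ordinary_unitRoot)
    (h61 : DeligneSerre1974.thm61_exists_adicGaloisRep)
    {N : ℕ} [NeZero N] (g : CuspForm (CongruenceSubgroup.Gamma0 N) 2) (hg : IsNewform0 g)
    (p : ℕ) [Fact p.Prime] (hp2 : p ≠ 2) (hpN : ¬ p ∣ N)
    (hord : ∀ ι' : PadicAlgCl p ≃+* ℂ, ‖ι'.symm (cuspCoeff g p)‖ = 1)
    (hKcl : ∃ (K : Type) (_ : Field K) (_ : NumberField K), IsImaginaryQuadratic K ∧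
        SatisfiesHeegnerHypothesis p K ∧
        ∃ χK : DirichletCharacter ℂ (NumberField.discr K).natAbs,
          (∀ n : ℕ, Odd n → χK n = (jacobiSym (NumberField.discr K) n : ℂ)) ∧
          ∀ ℓ : ℕ, ℓ.Prime → ¬ ℓ ∣ N → χK ℓ * cuspCoeff g ℓ = cuspCoeff g ℓ) :
    ∃ (ι' : PadicAlgCl p ≃+* ℂ) (ρ : FramedGaloisRep ℚ (PadicAlgCl p) 2),
      IsGaloisRepOfNewform1 (liftToGamma1 N 2 g)
        (ι'.symm.toRingHom.comp (algebraMap (coeffCharField (liftToGamma1 N 2 g)) ℂ))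
        {ℓ : ℕ | ℓ ∣ N * p} ρ ∧
      ρ.IsResiduallyAbsIrreducible ∧ ‖ι'.symm (cuspCoeff g p)‖ = 1 := by
  obtain ⟨ι', -⟩ := exists_padicAlgCl_ringEquiv_complex_apply_eq_of_finiteDimensional
    (algebraMap ℚ (PadicAlgCl p)) (algebraMap ℚ ℂ)
  obtain ⟨ρ, hρ, hres, -⟩ := exists_calibratorRep_of_CM_clause hW h61 g hg p hp2 hpN ι' (hord ι') hKcl
  exact ⟨ι', ρ, hρ, hres, hord ι'⟩

end Turnkey

/-! ## PART E — `CalibratorSupplyNF L p` ITSELF (all eight conjuncts), i.e. the statement of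
`bstw_door.stub_calibratorSupplyNF` (item 33169, S2a-NF) VERBATIM, from exactly THREE named printed facts:
`hW` (Hida 2000 Thm. 3.26 (2), GRANTED cell fact), `h61` (Deligne–Serre 1974 Thm. 6.1 / Deligne 1971,
named Literature fact) and `hPRE` (BSTW24 proof of Prop. 5.23 with App. B, typer fact p801618
`prop523proof_appB_exists_orientedCMNewform_PRE`).  Conjuncts: #1 `IsNewform0` (PRE) · #2 `p ∤ 2N` (PRE's
`p ∤ N` + `p ≥ 5` prime) · #3 #4 #5 (PART D) · #6 Heegner at `N` (PRE) · #7 analytic rank one (PRE's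
`HasAnalyticRankOneAt g`, definitionally the consumer's clause) · #8 (PRE's `TwistedLValueOneNeZero g χL`,
definitionally the consumer's 4-tuple after moving `LχL` out).  No curve appears; nothing about BSD. -/

section Supply

open Literature.NumberTheory.EllipticCurves.GreenbergSelmer Literature.FieldTheory.AlgClosed
open Literature.NumberTheory.EllipticCurves.BurungaleSkinnerTianWan2024
open Summit.BirchSwinnertonDyer.BirchSwinnertonDyer.Theorems

/-- **E (the supply turnkey) — `stub_calibratorSupplyNF` of `Cruxes/KatoValuationIneqNonsplitAtFive/Lines/bstw_door.lean`
token for token, from `hW`, `h61`, `hPRE`.**  At every admissible `(L, p)` — `p ≥ 5`, `L` imaginary quadratic,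
Heegner at `p`, `d_L < −4` odd — `CalibratorSupplyNF L p`.  (`d_L < −4` gives `d_L ≠ −4`; `d_L` odd gives
`d_L ≠ −8`; `p ≥ 5` gives `p ≠ 2`, whence `p ∤ 2N` from `p ∤ N`.)
[cite: BurungaleSkinnerTianWan2024, proof of Prop. 5.23 (TeX l.4587–4615) with App. B Lemma B.2 (l.6554–6583) and §7.2 l.6065]
[cite: Hida2000, Thm. 3.26 (2), p. 152] [cite: DeligneSerreASENS1974, Thm. 6.1] [cite: Ribet1977, Thm. (2.3)] -/
theorem calibratorSupplyNF_of_printedFacts (hW : Hida2000_thm326_ordinary_unitRoot)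
    (h61 : DeligneSerre1974.thm61_exists_adicGaloisRep)
    (hPRE : prop523proof_appB_exists_orientedCMNewform_PRE) :
    ∀ (p : ℕ) [Fact p.Prime], 5 ≤ p → ∀ (L : Type) [Field L] [NumberField L],
      IsImaginaryQuadratic L → SatisfiesHeegnerHypothesis p L → NumberField.discr L < -4 →
      Odd (NumberField.discr L) → ErratumRoadFiveBdvCalibrationSplitNF.CalibratorSupplyNF L p := by
  intro p _ hp5 L _ _ hL hHeeg hlt hodd
  have hp2 : p ≠ 2 := by omega
  have hd4 : NumberField.discr L ≠ -4 := by omega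
  have hd8 : NumberField.discr L ≠ -8 := by
    rintro h
    rw [h] at hodd
    exact absurd hodd (by decide)
  obtain ⟨N, _, g, hg, hpN, hHeegN, -, hKcl, hord, hrk1, χL, hχL, LχL, hdiff, hagree, hne⟩ :=
    hPRE p hp2 L hL hHeeg hd4 hd8
  obtain ⟨ι', ρ, hρ, hFirr, hap⟩ :=
    exists_compat_calibratorRep_of_CM_clause hW h61 g hg p hp2 hpN hord hKcl
  have hp2N : ¬ p ∣ 2 * N := by
    intro h
    have hp : p.Prime := Fact.out
    rcases hp.dvd_mul.mp h with h2 | hN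
    · exact hp2 ((Nat.prime_dvd_prime_iff_eq hp Nat.prime_two).mp h2)
    · exact hpN hN
  exact ⟨N, inferInstance, g, ι', ρ, hg, hp2N, hρ, hFirr, hap, hHeegN, hrk1, χL, LχL, hχL, hdiff,
    hagree, hne⟩

/-- **E′ (pointwise form)**: the same at one admissible `(L, p)`, hypotheses as the PRE fact wants them
(`p ≠ 2`, `d_L ∉ {−4, −8}`) — slightly more general than the stub's `p ≥ 5`, `d_L < −4` odd. -/
theorem calibratorSupplyNF_of_printedFacts' (hW : Hida2000_thm326_ordinary_unitRoot)
    (h61 : DeligneSerre1974.thm61_exists_adicGaloisRep)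
    (hPRE : prop523proof_appB_exists_orientedCMNewform_PRE)
    (p : ℕ) [Fact p.Prime] (hp2 : p ≠ 2) (L : Type) [Field L] [NumberField L]
    (hL : IsImaginaryQuadratic L) (hHeeg : SatisfiesHeegnerHypothesis p L)
    (hd4 : NumberField.discr L ≠ -4) (hd8 : NumberField.discr L ≠ -8) :
    ErratumRoadFiveBdvCalibrationSplitNF.CalibratorSupplyNF L p := by
  obtain ⟨N, _, g, hg, hpN, hHeegN, -, hKcl, hord, hrk1, χL, hχL, LχL, hdiff, hagree, hne⟩ :=
    hPRE p hp2 L hL hHeeg hd4 hd8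
  obtain ⟨ι', ρ, hρ, hFirr, hap⟩ :=
    exists_compat_calibratorRep_of_CM_clause hW h61 g hg p hp2 hpN hord hKcl
  have hp2N : ¬ p ∣ 2 * N := by
    intro h
    have hp : p.Prime := Fact.out
    rcases hp.dvd_mul.mp h with h2 | hN
    · exact hp2 ((Nat.prime_dvd_prime_iff_eq hp Nat.prime_two).mp h2)
    · exact hpN hN
  exact ⟨N, inferInstance, g, ι', ρ, hg, hp2N, hρ, hFirr, hap, hHeegN, hrk1, χL, LχL, hχL, hdiff,
    hagree, hne⟩

end Supply

end Summit.BirchSwinnertonDyer.BirchSwinnertonDyer.Theorems.ErratumRoadFiveBdvCalibrationSplitNFCalibratorSupply
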